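import Literature.MathematicalPhysics.QuantumFieldTheory.Balaban1983to89.Node00.Record13ResidualsR
import Literature.MathematicalPhysics.QuantumFieldTheory.Balaban1983to89.Node00.Record13Chi

/-!
# NODE 00 — χ-GENERIC RE-ISSUE (WORK ORDER RC-1 «RE-CENTRE THE RECORD», director-ym №462 (B) ∕ №467 (D) (ii) L-gen; CRIT-1 g33 RULING Q-3 (iii)) of
# `Node00/Record13ResidualsR` §2–§3: node00-def-K0a's generation-`j` PIN VALUE and RUN-INDEXED RESIDUAL 𝐓-WEIGHT FAMILY OF RECORD in the β-slot `χ` —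
# `stepWeightPinOfRecord₁₃Chi θ χ p`, `ZrOfRecord₁₃Chi θ χ p` + their faces and three laws (`…_chi`), receipts at `χ := chiβOfRecord₁₃ θ` (`rfl`), Ax instances

CITATION HEADER.  [III] = [Balaban1988Convergent] (CMP **119**) (1.11) p.248, (2.21) p.258, (3.2)–(3.5) pp.264–265, (3.16)–(3.20) pp.268–269, (3.23)–(3.25) p.270, p.267;
[I] = [Balaban1987RG1] (CMP **109**) (1.5) p.261, (2.9) p.266 (the cut-off's centre).  Every declaration of §G below is the VERBATIM body of the like-named declaration
of `Node00/Record13ResidualsR.lean` :94–:251 with EXACTLY the substitutions of [Ax-3b] `Node00/Record13Chi` (binder `(χ : ChiSlot F N)` after `θ`; `gOfRecord₁₃ F N θ p ↦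
gOfRecord₁₃Chi F N θ χ p`; defs `X ↦ XChi … χ`; theorems `↦ …_chi`); §1's `seqAllLargeOfRecord` and `univ_ne_empty_site` are centre-FREE and reused BY NAME.
NOTHING of record is edited (body-freeze №460 (2)).  WHY: `ZrOfRecord₁₃` is the fallback branch of DAG node N11's history-indexed residual 𝐓-weight certificate
`…N11HistoryPinnedResidualDefs.ZhPinOfRecord₁₃` and the diagonal pin of `…N11DiagonalOldBranchMeasurable` ∕ `…N11NoExpansionAtRecord13CoP` — the FIRST Literature
prerequisite of the χ-generic re-issue of N11's K1-face machine (dag-n11-d g44 `N11-G44-RC1-REACH-CENSUS.md`: 8 of its 26 centre-typed modules read these names).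
Custodians: node00-def-K0a ∕ def-T (the file of record), RC-1 hands PT-A-2; staged by dag-n11-d g44 as an OFFER — filed only on the custodian's word.
HONEST FRAMING.  Definitions re-issued over a parameter + `rfl`∕one-line faces + receipts; NOT print's (1.11)∕(3.16)–(3.20) resummation as a formula in `Y` (H3,
as the file of record says); nothing of Bałaban's asserted, ported or discharged; K0⁷∕K1⁹∕K3⁸ AS VETTED read the choice-centred cut-off; no `sorry`∕`instance`∕
`notation`; standard axioms; the YM mass gap (Clay) is NOT proved by any of this.
-/

noncomputable section

open MeasureTheory
open scoped BigOperators Matrix.Norms.L2Operator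

namespace Literature.MathematicalPhysics.QuantumFieldTheory.Balaban1983to89.Node00

open T4Continuum B14.Eq218Concrete B15DeterminingSets Tk

/-! ## §G. THE χ-GENERIC RE-ISSUE (verbatim bodies of `Record13ResidualsR` §2–§3) -/

/-! ### §G.2 The generation-`j` pin value, χ-generic -/

section PinValue

variable (F : T4Family) (N : ℕ) [NeZero N] (θ : Stage13Params F N) (χ : ChiSlot F N) (p : B12.RunParams)

/-- **THE GENERATION-`j` PIN VALUE** `ω ↦ w_j(s′_j(p))(V_j, V̄_j)`: def-T's resummed 𝐓-step weight ((3.2)–(3.5)·(3.16)·(3.20), Stage 9 `wOfRecord₉`) of the run `p` at level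
`j`, for the ALL-LARGE-FIELD new sequence of length `j+1`, read at the scale-`j` gauge variables `V_j = (ω j).1` and their one-step average `V̄_j` (the averaging of
record).  dag-n11-d's `a` (§3 of `…N11NoExpansionZetaSpecAtCoP`) is the case `j = 0`. It READS THE RUN (`ε_j(g_j)`, `δ_j(g_j)`; [III] (2.4), (3.2)–(3.4)).
[cite: Balaban1988Convergent, (1.11) p.248, (3.2)–(3.5) pp.264–265, (3.16) p.268, (3.20) p.269, p.267] -/
def stepWeightPinOfRecord₁₃Chi (j : ℕ) (ω : MultiCfg (F.P p.K) (SU N) (FluctV N)) : ℝ :=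
  wOfRecord₉ F N θ.toStage9Params p (gOfRecord₁₃Chi F N θ χ p) j (seqAllLargeOfRecord F θ.ν θ.τ9.M (gOfRecord₁₃Chi F N θ χ p) p.K (j + 1))
    (ω j).1 ((avOfRecord F N p.K j).avg (ω j).1)

variable {F N θ χ p}

/-- **THE PIN VALUE IS LOCAL AT SCALE `j`** (12b's `LocalLaws` shape): it reads `ω j` only. [cite: Balaban1988Convergent, (3.2)–(3.3) p.265, p.267] -/
theorem stepWeightPinOfRecord₁₃_local_chi (j : ℕ) {ω ω' : MultiCfg (F.P p.K) (SU N) (FluctV N)} (h : ω j = ω' j) :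
    stepWeightPinOfRecord₁₃Chi F N θ χ p j ω = stepWeightPinOfRecord₁₃Chi F N θ χ p j ω' := by
  unfold stepWeightPinOfRecord₁₃Chi
  rw [h]

/-- **THE PIN VALUE IS NONNEGATIVE** under unity of def-T's label residual `ζ` (`wOfRecord_nonneg_of_Omega_empty` at the all-large-field sequence).
[cite: Balaban1988Convergent, (3.2)–(3.3) p.265, (3.16) p.268] -/
theorem stepWeightPinOfRecord₁₃_nonneg_chi (hζu : IsZetaUnity F N θ.ν θ.τ9.M θ.ζ) (j : ℕ) (ω : MultiCfg (F.P p.K) (SU N) (FluctV N)) :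
    0 ≤ stepWeightPinOfRecord₁₃Chi F N θ χ p j ω :=
  wOfRecord_nonneg_of_Omega_empty F N θ.ν θ.τ9.M θ.A₁ p (gOfRecord₁₃Chi F N θ χ p) j hζu _ rfl _ _

/-- **THE PIN VALUE IS AT MOST ONE** under unity of def-T's label residual `ζ` (`wOfRecord_le_one_of_Omega_empty`). [cite: Balaban1988Convergent, (3.2)–(3.3) p.265, (3.16) p.268] -/
theorem stepWeightPinOfRecord₁₃_le_one_chi (hζu : IsZetaUnity F N θ.ν θ.τ9.M θ.ζ) (j : ℕ) (ω : MultiCfg (F.P p.K) (SU N) (FluctV N)) :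
    stepWeightPinOfRecord₁₃Chi F N θ χ p j ω ≤ 1 :=
  wOfRecord_le_one_of_Omega_empty F N θ.ν θ.τ9.M θ.A₁ p (gOfRecord₁₃Chi F N θ χ p) j hζu _ rfl _ _

/-- **THE PIN VALUE AT g3's TWO-SCALE CONFIGURATION `(V_j, V_{j+1}) = (U, V′)`** is `w_j(s′_j)(U, Ū)` — dag-n11-d's spec hypothesis shape at generation `j`.
[cite: Balaban1988Convergent, (2.21) p.258, (3.24) p.270 (bookkeeping)] -/
theorem stepWeightPinOfRecord₁₃_pairCfgAt_chi (j : ℕ) (V' : GaugeField (F.P p.K) (j + 1) (SU N)) (U : GaugeField (F.P p.K) j (SU N)) :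
    stepWeightPinOfRecord₁₃Chi F N θ χ p j (pairCfgAt (V := FluctV N) j V' U) =
      wOfRecord₉ F N θ.toStage9Params p (gOfRecord₁₃Chi F N θ χ p) j (seqAllLargeOfRecord F θ.ν θ.τ9.M (gOfRecord₁₃Chi F N θ χ p) p.K (j + 1))
        U ((avOfRecord F N p.K j).avg U) := by
  unfold stepWeightPinOfRecord₁₃Chi
  rw [pairCfgAt_self]

/-- **THE PIN VALUE AT 11a's TWO-SCALE CONFIGURATION `(V₀, V₁) = (U, V₁)`** (generation `0`) is `w(s′)(U, Ū)` — dag-n11-d's hypothesis `hZ` of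
`slotsT_one_ae_eq_sect2Slot[_CoP]_of_zeta0_pin`. [cite: Balaban1988Convergent, (1.11) p.248, (2.21) p.258 (bookkeeping)] -/
theorem stepWeightPinOfRecord₁₃_pairCfg_chi (V1 : GaugeField (F.P p.K) 1 (SU N)) (Uf : GaugeField (F.P p.K) 0 (SU N)) :
    stepWeightPinOfRecord₁₃Chi F N θ χ p 0 (pairCfg (V := FluctV N) V1 Uf) =
      wOfRecord₉ F N θ.toStage9Params p (gOfRecord₁₃Chi F N θ χ p) 0 (seqAllLargeOfRecord F θ.ν θ.τ9.M (gOfRecord₁₃Chi F N θ χ p) p.K 1)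
        Uf ((avOfRecord F N p.K 0).avg Uf) := by
  unfold stepWeightPinOfRecord₁₃Chi
  rw [pairCfg_zero]

end PinValue

/-! ### §G.3 ★★★ The run-indexed residual of record and its three laws -/

section Residual

variable (F : T4Family) (N : ℕ) [NeZero N] (θ : Stage13Params F N) (χ : ChiSlot F N) (p : B12.RunParams)

open Classical in
/-- **★★★ THE RUN-INDEXED RESIDUAL 𝐓-WEIGHT FAMILY OF RECORD** on the torus of the run `p` (the VALUE of node00-def-T's v1.6 field `Stage13RParams.Zr p` at node00-def-K0a's
witnesses; director-ym №174 (5)): at the generations `j < K` of the run, `ζ0_j(T) :=` the pin value `w_j(s′_j(p))(V_j, V̄_j)` (§2), `ζ0_j(∅) := 1 −` it, `ζ0_j(Y) := 0` for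
every other region label; at `j ≥ K` (no 𝐓-step of the run reads them) node00-def-K0b's uniform factor `ZtOfRecord`; `quad := 0` ([I]'s `𝒬_j` not constructed in the tree —
the Gaussian placeholder dag-n11-d's spec asks on `∅`).  dag-n11-d's generation-0 cure `exists_residual_clause_one_CoP` is this datum at `j = 0`; def-T memo §6's diagonal
family is this datum at every `j < K`.  NOT print's (1.11)∕(3.16)–(3.20) resummation as a formula in `Y` (H3); it agrees with it where the no-expansion diagonal reads it.
[cite: Balaban1988Convergent, (1.11) p.248, p.267, (3.16)–(3.20) pp.268–269, (2.21) p.258, (3.23)–(3.25) p.270; Balaban1987RG1, (1.5) p.261] -/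
def ZrOfRecord₁₃Chi : TkResidualW F N (FluctV N) p.K where
  ζ0 := fun j Y ω =>
    if j < p.K then (if Y = Set.univ then stepWeightPinOfRecord₁₃Chi F N θ χ p j ω else if Y = ∅ then 1 - stepWeightPinOfRecord₁₃Chi F N θ χ p j ω else 0)
    else (ZtOfRecord F N p.K).ζ0 j Y ω
  quad := fun _ _ _ => 0

variable {F N θ χ p}

/-- `ζ0_j(T)` at a generation of the run is the pin value. [cite: Balaban1988Convergent, (1.11) p.248, p.267 (bookkeeping)] -/
theorem ZrOfRecord₁₃_ζ0_univ_chi {j : ℕ} (hj : j < p.K) (ω : MultiCfg (F.P p.K) (SU N) (FluctV N)) :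
    (ZrOfRecord₁₃Chi F N θ χ p).ζ0 j Set.univ ω = stepWeightPinOfRecord₁₃Chi F N θ χ p j ω := by
  simp only [ZrOfRecord₁₃Chi, if_pos hj, if_true]

/-- `ζ0_j(∅)` at a generation of the run is the complement `1 − ζ0_j(T)`. [cite: Balaban1988Convergent, (3.16)–(3.20) pp.268–269 (bookkeeping)] -/
theorem ZrOfRecord₁₃_ζ0_empty_chi {j : ℕ} (hj : j < p.K) (ω : MultiCfg (F.P p.K) (SU N) (FluctV N)) :
    (ZrOfRecord₁₃Chi F N θ χ p).ζ0 j ∅ ω = 1 - stepWeightPinOfRecord₁₃Chi F N θ χ p j ω := by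
  simp only [ZrOfRecord₁₃Chi, if_pos hj, if_neg (Ne.symm (univ_ne_empty_site (F := F) p.K)), if_true]

/-- `ζ0_j(Y) = 0` at a generation of the run for every region label other than `T` and `∅` (located: by fiat, not print). [cite: Balaban1988Convergent, p.267 (bookkeeping)] -/
theorem ZrOfRecord₁₃_ζ0_of_ne_of_ne_chi {j : ℕ} (hj : j < p.K) {Y : Set (Site (F.P p.K) 0)} (hT : Y ≠ Set.univ) (h0 : Y ≠ ∅)
    (ω : MultiCfg (F.P p.K) (SU N) (FluctV N)) : (ZrOfRecord₁₃Chi F N θ χ p).ζ0 j Y ω = 0 := by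
  simp only [ZrOfRecord₁₃Chi, if_pos hj, if_neg hT, if_neg h0]

/-- Above the run's length the residual is node00-def-K0b's uniform factor. [cite: Balaban1988Convergent, p.267 (bookkeeping)] -/
theorem ZrOfRecord₁₃_ζ0_of_le_chi {j : ℕ} (hj : p.K ≤ j) (Y : Set (Site (F.P p.K) 0)) (ω : MultiCfg (F.P p.K) (SU N) (FluctV N)) :
    (ZrOfRecord₁₃Chi F N θ χ p).ζ0 j Y ω = (ZtOfRecord F N p.K).ζ0 j Y ω := by
  simp only [ZrOfRecord₁₃Chi, if_neg (Nat.not_lt.mpr hj)]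

/-- `quad ≡ 0` (the Gaussian placeholder). [cite: Balaban1988Convergent, (3.23) p.270 (bookkeeping)] -/
@[simp] theorem ZrOfRecord₁₃_quad_chi (j : ℕ) (Λ' : Set (Site (F.P p.K) 0)) (ω : MultiCfg (F.P p.K) (SU N) (FluctV N)) :
    (ZrOfRecord₁₃Chi F N θ χ p).quad j Λ' ω = 0 := rfl

/-- **★ 12a's RESIDUAL LAW `ζ0 ≥ 0`** for the run-indexed residual of record (the future row `zrLaws p`), under unity of def-T's label residual `θ.ζ` (`0 ≤ w ≤ 1`).
[cite: Balaban1988Convergent, p.267, (3.2)–(3.3) p.265, (3.16) p.268] -/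
theorem laws_ZrOfRecord₁₃_chi (hζu : IsZetaUnity F N θ.ν θ.τ9.M θ.ζ) : (ZrOfRecord₁₃Chi F N θ χ p).Laws := by
  refine ⟨fun j Y ω => ?_⟩
  by_cases hj : j < p.K
  · by_cases hT : Y = Set.univ
    · subst hT
      rw [ZrOfRecord₁₃_ζ0_univ_chi hj]
      exact stepWeightPinOfRecord₁₃_nonneg_chi hζu j ω
    · by_cases h0 : Y = ∅
      · subst h0
        rw [ZrOfRecord₁₃_ζ0_empty_chi hj]
        exact sub_nonneg.mpr (stepWeightPinOfRecord₁₃_le_one_chi hζu j ω)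
      · rw [ZrOfRecord₁₃_ζ0_of_ne_of_ne_chi hj hT h0]
  · rw [ZrOfRecord₁₃_ζ0_of_le_chi (Nat.not_lt.mp hj)]
    exact (ZtOfRecord_ζ0_pos F N p.K j Y ω).le

/-- **★ 12b's LOCALITY LAW** for the run-indexed residual of record (the future row `zrLocal p`): `ζ0_j(Y)` reads the scale-`j` configuration only — the pin value
does (§2), K0b's factor reads nothing. [cite: Balaban1988Convergent, (3.2)–(3.3) p.265, p.267] -/
theorem localLaws_ZrOfRecord₁₃_chi : (ZrOfRecord₁₃Chi F N θ χ p).LocalLaws := by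
  refine ⟨fun j Y ω ω' h => ?_⟩
  -- arity-robust: `key` is the one-scale equation; `tauto` serves it under the one-scale row AND under the two-scale row of record
  -- (`ω j = ω' j → (ω (j+1)).1 = (ω' (j+1)).1 → …`, [B14] (3.1) p.264), where one more hypothesis is in context.
  have key : (ZrOfRecord₁₃Chi F N θ χ p).ζ0 j Y ω = (ZrOfRecord₁₃Chi F N θ χ p).ζ0 j Y ω' := by
    by_cases hj : j < p.K
    · simp only [ZrOfRecord₁₃Chi, if_pos hj, stepWeightPinOfRecord₁₃_local_chi j h]
    · rw [ZrOfRecord₁₃_ζ0_of_le_chi (Nat.not_lt.mp hj), ZrOfRecord₁₃_ζ0_of_le_chi (Nat.not_lt.mp hj)]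
      rfl
  tauto

/-- **★ PRINT'S PARTITION OF UNITY AT EVERY GENERATION** for the run-indexed residual of record (the future guard `Stage13RParams.ZrUnity` at the pin):
`Σᶠ_Y ζ0_j(Y)(ω) = ζ0_j(T) + ζ0_j(∅) = 1` at `j < K`, K0b's `finsum_ζ0_ZtOfRecord` above. [cite: Balaban1988Convergent, (3.16)–(3.20) pp.268–269] -/
theorem finsum_ζ0_ZrOfRecord₁₃_chi (j : ℕ) (ω : MultiCfg (F.P p.K) (SU N) (FluctV N)) :
    (∑ᶠ Y : Set (Site (F.P p.K) 0), (ZrOfRecord₁₃Chi F N θ χ p).ζ0 j Y ω) = 1 := by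
  classical
  by_cases hj : j < p.K
  · haveI : Fintype (Set (Site (F.P p.K) 0)) := Fintype.ofFinite _
    have hne : (Set.univ : Set (Site (F.P p.K) 0)) ≠ ∅ := univ_ne_empty_site (F := F) p.K
    rw [finsum_eq_sum_of_fintype,
      Finset.sum_eq_add_of_mem (Set.univ : Set (Site (F.P p.K) 0)) ∅ (Finset.mem_univ _) (Finset.mem_univ _) hne]
    · rw [ZrOfRecord₁₃_ζ0_univ_chi hj, ZrOfRecord₁₃_ζ0_empty_chi hj]
      ring
    · intro Y _ hY
      exact ZrOfRecord₁₃_ζ0_of_ne_of_ne_chi hj hY.1 hY.2 ω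
  · rw [show (fun Y : Set (Site (F.P p.K) 0) => (ZrOfRecord₁₃Chi F N θ χ p).ζ0 j Y ω) = fun Y => (ZtOfRecord F N p.K).ζ0 j Y ω from
      funext fun Y => ZrOfRecord₁₃_ζ0_of_le_chi (Nat.not_lt.mp hj) Y ω]
    exact finsum_ζ0_ZtOfRecord F N p.K j ω

/-- **THE GENERATION-0 PIN FACE** (dag-n11-d's hypothesis `hZ` of `slotsT_one_ae_eq_sect2Slot[_CoP]_of_zeta0_pin`, `0 < K`): at 11a's two-scale configuration
`ζ0_0(T)(U, V₁) = w(s′₀)(U, Ū)`. [cite: Balaban1988Convergent, (1.11) p.248, (2.21) p.258, (3.25) p.270] -/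
theorem ZrOfRecord₁₃_ζ0_zero_univ_pairCfg_chi (hK : 0 < p.K) (V1 : GaugeField (F.P p.K) 1 (SU N)) (Uf : GaugeField (F.P p.K) 0 (SU N)) :
    (ZrOfRecord₁₃Chi F N θ χ p).ζ0 0 Set.univ (pairCfg (V := FluctV N) V1 Uf) =
      wOfRecord₉ F N θ.toStage9Params p (gOfRecord₁₃Chi F N θ χ p) 0 (seqAllLargeOfRecord F θ.ν θ.τ9.M (gOfRecord₁₃Chi F N θ χ p) p.K 1)
        Uf ((avOfRecord F N p.K 0).avg Uf) := by
  rw [ZrOfRecord₁₃_ζ0_univ_chi hK, stepWeightPinOfRecord₁₃_pairCfg_chi]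

/-- **THE GENERATION-`j` PIN FACE** (dag-n11-d's generation-`j` spec `slotsT_succ_ae_eq_sect2Slot_of_zetaSpecAt` with `c = 1`, `j < K`): at g3's two-scale configuration
`ζ0_j(T)(U, V′) = w_j(s′_j)(U, Ū)`. [cite: Balaban1988Convergent, (2.21) p.258, (3.24)–(3.25) p.270] -/
theorem ZrOfRecord₁₃_ζ0_univ_pairCfgAt_chi {j : ℕ} (hj : j < p.K) (V' : GaugeField (F.P p.K) (j + 1) (SU N)) (U : GaugeField (F.P p.K) j (SU N)) :
    (ZrOfRecord₁₃Chi F N θ χ p).ζ0 j Set.univ (pairCfgAt (V := FluctV N) j V' U) =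
      wOfRecord₉ F N θ.toStage9Params p (gOfRecord₁₃Chi F N θ χ p) j (seqAllLargeOfRecord F θ.ν θ.τ9.M (gOfRecord₁₃Chi F N θ χ p) p.K (j + 1))
        U ((avOfRecord F N p.K j).avg U) := by
  rw [ZrOfRecord₁₃_ζ0_univ_chi hj, stepWeightPinOfRecord₁₃_pairCfgAt_chi]

/-- The `quad` pin face at 11a's two-scale configuration (dag-n11-d's hypothesis `hq`): `quad_0(∅)(U, V₁) = 0`. [cite: Balaban1988Convergent, (3.23) p.270 (bookkeeping)] -/
theorem ZrOfRecord₁₃_quad_zero_empty_pairCfg_chi (V1 : GaugeField (F.P p.K) 1 (SU N)) (Uf : GaugeField (F.P p.K) 0 (SU N)) :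
    (ZrOfRecord₁₃Chi F N θ χ p).quad 0 ∅ (pairCfg (V := FluctV N) V1 Uf) = 0 := rfl

end Residual

/-! ## §R. RECEIPTS at the choice centre `χ := chiβOfRecord₁₃ θ` and the Ax INSTANCES (director-ym №467 (ii)) -/

section Receipts

variable {F : T4Family} {N : ℕ} [NeZero N] (θ : Stage13Params F N) (p : B12.RunParams)

/-- Receipt (`rfl`): at the choice centre the χ-generic pin value IS the pin value of record. [cite: Balaban1988Convergent, (1.11) p.248 (bookkeeping)] -/
theorem stepWeightPinOfRecord₁₃Chi_chiβ : stepWeightPinOfRecord₁₃Chi F N θ (chiβOfRecord₁₃ F N θ) p = stepWeightPinOfRecord₁₃ F N θ p := rfl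

/-- Receipt (`rfl`): at the choice centre the χ-generic run-indexed residual IS the residual of record. [cite: Balaban1988Convergent, p.267 (bookkeeping)] -/
theorem ZrOfRecord₁₃Chi_chiβ : ZrOfRecord₁₃Chi F N θ (chiβOfRecord₁₃ F N θ) p = ZrOfRecord₁₃ F N θ p := rfl

variable (F N) in
/-- **THE PIN VALUE OF RECORD, RE-CENTRED** (`χ := chiβOfRecord₁₃Ax θ`). [cite: Balaban1988Convergent, (1.11) p.248; Balaban1987RG1, (2.9) p.266] -/
abbrev stepWeightPinOfRecord₁₃Ax (θ : Stage13Params F N) (p : B12.RunParams) (j : ℕ) (ω : MultiCfg (F.P p.K) (SU N) (FluctV N)) : ℝ :=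
  stepWeightPinOfRecord₁₃Chi F N θ (chiβOfRecord₁₃Ax F N θ) p j ω

variable (F N) in
/-- **THE RUN-INDEXED RESIDUAL 𝐓-WEIGHT FAMILY OF RECORD, RE-CENTRED** (`χ := chiβOfRecord₁₃Ax θ`). [cite: Balaban1988Convergent, p.267, (3.16)–(3.20) pp.268–269; Balaban1987RG1, (2.9) p.266] -/
abbrev ZrOfRecord₁₃Ax (θ : Stage13Params F N) (p : B12.RunParams) : TkResidualW F N (FluctV N) p.K :=
  ZrOfRecord₁₃Chi F N θ (chiβOfRecord₁₃Ax F N θ) p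

end Receipts

end Literature.MathematicalPhysics.QuantumFieldTheory.Balaban1983to89.Node00

end
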